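import Summits.AtomisticToContinuum.HydrodynamicLimit.Theorems.JParityClosureEvenStressEnskogFixedTimeVarianceReduction
import Summits.AtomisticToContinuum.HydrodynamicLimit.Theorems.JParityClosureEvenStressEnskogTubeVarianceRung0
import Summits.AtomisticToContinuum.HydrodynamicLimit.Theorems.InformationPercolationEngineCollisionRateTubeRegular
import Literature.MathematicalPhysics.KineticTheory.CollisionTubeVarianceRung0SpeedCutoffMark
import Literature.MathematicalPhysics.KineticTheory.EnskogRateVarianceRung0BoundedMark
import HarnessLib

/-!
# R4 · the fixed-time variance of the even tube functional at rung 0, UNIT mark, modulo the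
# decorrelation plateau Plateau′ (`stub_fixedTimeVarianceUnitRung0`, line `Sketch`, crux
# `InformationPercolationEngine.CollisionRate`, stmt-AtomisticToContinuum-13481)

RUNG 0 = constant profiles `(a, u, θ)`: the local Gibbs law is the homogeneous canonical Gibbs law `G_N`,
invariant under every hard-sphere flow, so for every `t ≤ τ` the fixed-time variance `Var_{G_N}(W_t ∘ Φ_t)` of
the even tube functional `W_t = A_t − σ³ e_t` at the speed-truncated UNIT mark `Ξ₁ᴸ(n, v, w) = ψ_L(‖w − v‖)` is the
STATIC variance `Var_{G_N}(W_t) ≤ 2 Var(A_t) + 2 σ⁶ Var(e_t)` (`Theorems.EvenStressEnskog.variance_comp_flow_localGibbsLaw_const`,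
`variance_evenTubeStat_flow_le`).  This file is the mark-`Ξ₁ᴸ` twin of the sibling crux's
(`JParityClosure.EvenStressEnskog`, stmt-13079) `stub_tubeVarianceRung0_of_plateau2` + `stub_enskogRateVarianceRung0` +
`fixedTimeVariance_rung0_of_static`, which are hard-wired to the truncated even marks `Ξ_L^{kl}`; the mark-generic
analysis is in the tree (`Literature.….CollisionTubeVarianceRung0SpeedCutoffMark`: the static tube variance for any
measurable mark `|Ξ| ≤ C` with a speed cutoff, run on the ALMOST-SURE double-sum form — grazing pairs are `G_N`-null, no
vanishing at grazing normals is needed; `Literature.….EnskogRateVarianceRung0BoundedMark`: the mean-square deviation of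
the Enskog integrand and `Var_{G_N}(e_t) ≤ C_χ² ∫ J_N → 0` for any continuous mark with `|Θ Ξ| ≤ C_Θ`):

* `enskogRateVariance_unit_rung0` — (hE)₀ at `Ξ₁ᴸ` (`|Θ Ξ₁ᴸ| ≤ 2L|S²|`, `abs_sphereMark_speedCutoff_le`): thresholds
  `η₀, σ₀, r₀ = 1/4, N₀` as in the sibling, the equation of state being the tree theorem `hsEosLowDensity_JParityClosure`;
* `tubeVariance_unit_rung0_of_plateau` — (hA)₀ at `Ξ₁ᴸ` modulo Plateau′ (`|Ξ₁ᴸ| ≤ 1`, `Ξ₁ᴸ = 0` at relative speed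
  `≥ 2L`): the four-term bound `K₁/(N+1) + K₂ ζ + K₃ ζ'² + K₄ P_N(Bad)` at `C = 1` and the sibling's choice of
  `ζ, ζ', δ, N₀`;
* `fixedTimeVariance_unit_rung0_of_static` and the registered stub `stub_fixedTimeVarianceUnitRung0`.

References: H. Spohn, *Large Scale Dynamics of Interacting Particles* (1991), Part I §2.3; D. Ruelle,
*Statistical Mechanics: Rigorous Results* (1969) §4.2; S. Boucheron, O. Bousquet, G. Lugosi (2004) §2.
-/

noncomputable section

open MeasureTheory ProbabilityTheory Set Filter Topology Function
open scoped ENNReal InnerProductSpace BigOperators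

namespace Summit.AtomisticToContinuum.HydrodynamicLimit.Theorems.CollisionRate

open Literature.Analysis.FluidPDE Literature.MathematicalPhysics.KineticTheory
open Literature.MathematicalPhysics.StatisticalMechanics Literature.Probability.Moments
open Summit.AtomisticToContinuum.HydrodynamicLimit.Theorems.EvenStressEnskog

/-! ## The Enskog half at the unit mark `Ξ₁ᴸ` -/

/-- **(hE)₀ at the unit mark · the Enskog rate functional at `Ξ₁ᴸ` is measurable and has vanishing STATIC Gibbs
variance at rung 0** (mark-`Ξ₁ᴸ` twin of `Theorems.EvenStressEnskog.stub_enskogRateVarianceRung0`, static form — the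
flow is removed in the assembly by Gibbs invariance).  `η₀ := min (η'/2) η₁` (`η'` the analyticity radius of the
equation of state, `η₁` the cutoff scale of `exists_bound_mul_contactValue`), `σ₀ := min σ₁ (η₀/2)`, `r₀ := 1/4`;
`ψ = g · Y` is then bounded on `[0, ∞)` and continuous at `σ³`; `N₀` from
`Literature.….tendsto_integral_integral_sq_deviation_of_abs_sphereMark_le` at `|Θ Ξ₁ᴸ| ≤ 2L|S²|`, and
`Var ≤ C_χ² ∫ J_N` (`Literature.….variance_enskogRate_le_sq_mul_integral_sq_deviation`).  `κ` is not used. [folklore] -/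
theorem enskogRateVariance_unit_rung0 :
    ∃ η₀ : ℝ, 0 < η₀ ∧ ∀ (a θ : ℝ) (u : V3), 0 < a → 0 < θ → ∃ σ₀ : ℝ, 0 < σ₀ ∧ ∀ σ : ℝ, 0 < σ → σ < σ₀ →
      ∀ Φ : (N : ℕ) → HardSphereFlow (Torus.geometry (Fin 3)) (hsDiameter σ N) (N + 1), ∀ τ : ℝ, 0 < τ →
      ∀ χ : ℝ × UnitAddTorus (Fin 3) → ℝ, Continuous χ → ∀ g : ℝ → ℝ, Continuous g →
      (∀ a', η₀ ≤ a' → g a' = 0) → ∀ ς : ℝ, 0 < ς → ∃ r₀ : ℝ, 0 < r₀ ∧ ∀ r : ℝ, 0 < r → r < r₀ →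
      ∀ L κ : ℝ, 1 ≤ L → 0 < κ → κ ≤ 1 → ∃ N₀ : ℕ, ∀ N : ℕ, N₀ ≤ N → ∀ t ∈ Set.Icc (0 : ℝ) τ,
      (Measurable fun z => enskogRate σ N χ g (fun q : V3 × V3 × V3 => speedCutoff L ‖q.2.2 - q.2.1‖) r t z) ∧
      ProbabilityTheory.variance
        (fun z => enskogRate σ N χ g (fun q : V3 × V3 × V3 => speedCutoff L ‖q.2.2 - q.2.1‖) r t z)
        (localGibbsLaw σ (fun _ => a) (fun _ => u) (fun _ => θ) N (Φ N)) ≤ ς := by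
  obtain ⟨η₁, hη₁, hbound⟩ := exists_bound_mul_contactValue hsEosLowDensity_JParityClosure
  obtain ⟨η', hη', F, hF, hEq, -, -, -⟩ := hsEosLowDensity_JParityClosure
  refine ⟨min (η' / 2) η₁, lt_min (by positivity) hη₁, ?_⟩
  intro a θ u ha hθ
  obtain ⟨σ₁, hσ₁, hsmall⟩ := exists_smallDensity uniformProfile one_pos
  refine ⟨min σ₁ (min (η' / 2) η₁ / 2), lt_min hσ₁ (by positivity), ?_⟩
  intro σ hσ hσσ₀ Φ τ hτ χ hχ g hg hg0 ς hς
  have hsd : SmallDensity uniformProfile σ := (hsmall σ hσ (hσσ₀.trans_le (min_le_left _ _))).1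
  have hσ2 : σ ≤ 1 / 2 := hsd.σ_lt_half.le
  have hσ3 : σ ^ 3 < min (η' / 2) η₁ := by
    have h1 : σ ^ 3 ≤ σ ^ 1 := pow_le_pow_of_le_one hσ.le (by linarith) (by norm_num)
    have h2 : σ < min (η' / 2) η₁ / 2 := hσσ₀.trans_le (min_le_right _ _)
    rw [pow_one] at h1
    linarith
  refine ⟨1 / 4, by norm_num, ?_⟩
  intro r hr hr4 L κ hL _hκ _hκ1
  have hr2 : r < 1 / 2 := by linarith
  have hL0 : 0 < L := by linarith
  -- `ψ = g · Y`: measurable, bounded on `[0, ∞)`, continuous at `σ³ ∈ (0, η')`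
  obtain ⟨K, -, hK⟩ := hbound g hg fun b hb => hg0 b ((min_le_right _ _).trans hb)
  have hs : 0 < σ ^ 3 := pow_pos hσ 3
  have hs' : σ ^ 3 < η' := by have := (lt_min_iff.1 hσ3).1; linarith
  have hψm : Measurable fun b => g b * contactValue b := hg.measurable.mul measurable_contactValue
  have hψc : ContinuousAt (fun b => g b * contactValue b) (σ ^ 3) := by
    have hnhds : hsExcessFreeEnergy =ᶠ[𝓝 (σ ^ 3)] F :=
      Filter.eventuallyEq_of_mem (isOpen_Ioo.mem_nhds ⟨hs, hs'⟩) (hEq.mono Ioo_subset_Ico_self)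
    have hY : (fun b => 3 / (2 * Real.pi) * deriv F b) =ᶠ[𝓝 (σ ^ 3)] contactValue :=
      hnhds.deriv.mono fun b hb => by rw [contactValue, hb]
    have hFc : ContinuousAt (deriv F) (σ ^ 3) :=
      hF.deriv.continuousOn.continuousAt (isOpen_Ioo.mem_nhds ⟨by linarith, hs'⟩)
    exact hg.continuousAt.mul ((hFc.const_mul _).congr hY)
  -- `χ` is bounded on `[0, τ] × 𝕋³`; the mark `Ξ₁ᴸ` and the static limit
  obtain ⟨Cχ, hCχ, hχb⟩ := exists_pos_bound_on_strip hχ τ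
  have hΞc : Continuous fun q : V3 × V3 × V3 => speedCutoff L ‖q.2.2 - q.2.1‖ := continuous_speedCutoff_mark L
  have hΘb := fun v w => abs_sphereMark_speedCutoff_le hL0 v w
  have hς' : 0 < ς / (Cχ ^ 2 + 1) := by positivity
  obtain ⟨N₀, hN₀⟩ := eventually_atTop.1
    ((tendsto_integral_integral_sq_deviation_of_abs_sphereMark_le hsd ha hθ hψm hK hψc hΞc hΘb hr hr2 Φ).eventually
      (gt_mem_nhds hς'))
  refine ⟨N₀, fun N hN t ht => ⟨?_, ?_⟩⟩
  · exact (measurable_enskogRate_uncurry σ N hχ hg hΞc r).comp (measurable_const.prodMk measurable_id)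
  · calc _ ≤ Cχ ^ 2 * _ := variance_enskogRate_le_sq_mul_integral_sq_deviation hσ hσ2 ha hθ hχ (hχb t ht) hg hK
          hΞc hΘb hr N (Φ N)
      _ ≤ Cχ ^ 2 * (ς / (Cχ ^ 2 + 1)) := mul_le_mul_of_nonneg_left (hN₀ N hN).le (sq_nonneg _)
      _ ≤ ς := by
          rw [show Cχ ^ 2 * (ς / (Cχ ^ 2 + 1)) = ς * (Cχ ^ 2 / (Cχ ^ 2 + 1)) by ring]
          have h1 : Cχ ^ 2 / (Cχ ^ 2 + 1) ≤ 1 := (div_le_one (by positivity)).2 (by linarith)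
          calc ς * (Cχ ^ 2 / (Cχ ^ 2 + 1)) ≤ ς * 1 := mul_le_mul_of_nonneg_left h1 hς.le
            _ = ς := mul_one ς

/-! ## The tube half at the unit mark `Ξ₁ᴸ`, modulo Plateau′ -/

/-- **(hA)₀ at the unit mark, modulo the plateau**: the plateau hypothesis (Plateau′) — relative asymptotic
independence of two disjoint decorated dimers under the activity-`1` canonical configurational measure, with
bounded absolute-position weights — implies the static tube-variance input at the speed-truncated unit mark
`Ξ₁ᴸ` (`|Ξ₁ᴸ| ≤ 1`, vanishing at relative speed `≥ 2L`): port of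
`Theorems.EvenStressEnskog.stub_tubeVarianceRung0_of_plateau2`, the bookkeeping being
`variance_tubeStat_rung0_le_of_speedCutoff` at `C = 1`; `η₀ = 1`, `σ₀ = min σ₁ σ₂`, `r₀ = 1/4`. [folklore] -/
theorem tubeVariance_unit_rung0_of_plateau
    (hPl : ∃ σ₁ : ℝ, 0 < σ₁ ∧ ∀ σ : ℝ, 0 < σ → σ < σ₁ → ∀ ζ : ℝ, 0 < ζ → ∃ N₀ : ℕ, ∀ N : ℕ, N₀ ≤ N →
      ∀ i j k l : Fin (N + 1), i ≠ j → i ≠ k → i ≠ l → j ≠ k → j ≠ l → k ≠ l →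
      ∀ (h h' : T3 → ℝ), Measurable h → Measurable h' → (∀ y, |h y| ≤ 1) → (∀ y, |h' y| ≤ 1) →
      ∀ T T' : Set T3, MeasurableSet T → MeasurableSet T' →
        |(∫ x, h (x i) * T.indicator (fun _ => (1 : ℝ)) (x j - x i) * (h' (x k) * T'.indicator (fun _ => (1 : ℝ)) (x l - x k))
            ∂posGibbsMeasure (fun _ : T3 => (1 : ℝ)) (hsDiameter σ N) (N + 1)) -
          (∫ x, h (x i) * T.indicator (fun _ => (1 : ℝ)) (x j - x i)
            ∂posGibbsMeasure (fun _ : T3 => (1 : ℝ)) (hsDiameter σ N) (N + 1)) *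
          (∫ x, h' (x k) * T'.indicator (fun _ => (1 : ℝ)) (x l - x k)
            ∂posGibbsMeasure (fun _ : T3 => (1 : ℝ)) (hsDiameter σ N) (N + 1))| ≤
        ζ * (MeasureTheory.volume T).toReal * (MeasureTheory.volume T').toReal) :
    ∃ η₀ : ℝ, 0 < η₀ ∧ ∀ (a θ : ℝ) (u : V3), 0 < a → 0 < θ → ∃ σ₀ : ℝ, 0 < σ₀ ∧ ∀ σ : ℝ, 0 < σ → σ < σ₀ →
      ∀ Φ : (N : ℕ) → HardSphereFlow (Torus.geometry (Fin 3)) (hsDiameter σ N) (N + 1), ∀ τ : ℝ, 0 < τ →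
      ∀ χ : ℝ × UnitAddTorus (Fin 3) → ℝ, Continuous χ → ∀ g : ℝ → ℝ, Continuous g →
      (∀ a', η₀ ≤ a' → g a' = 0) → ∀ ς : ℝ, 0 < ς → ∃ r₀ : ℝ, 0 < r₀ ∧ ∀ r : ℝ, 0 < r → r < r₀ →
      ∀ L κ : ℝ, 1 ≤ L → 0 < κ → κ ≤ 1 → ∃ N₀ : ℕ, ∀ N : ℕ, N₀ ≤ N → ∀ t ∈ Set.Icc (0 : ℝ) τ,
        ProbabilityTheory.variance
          (fun z => tubeStat σ N χ g (fun q : V3 × V3 × V3 => speedCutoff L ‖q.2.2 - q.2.1‖) r r 1 κ t z)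
          (localGibbsLaw σ (fun _ => a) (fun _ => u) (fun _ => θ) N (Φ N)) ≤ ς := by
  obtain ⟨σ₁, hσ₁, hPl⟩ := hPl
  refine ⟨1, one_pos, ?_⟩
  intro a θ u ha hθ
  obtain ⟨σ₂, hσ₂, hsmall⟩ := exists_smallDensity uniformProfile one_pos
  refine ⟨min σ₁ σ₂, lt_min hσ₁ hσ₂, ?_⟩
  intro σ hσ hσlt Φ τ hτ χ hχ g hg hg0 ς hς
  have hsd : SmallDensity uniformProfile σ := (hsmall σ hσ (lt_of_lt_of_le hσlt (min_le_right _ _))).1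
  have hσ1 : σ < σ₁ := lt_of_lt_of_le hσlt (min_le_left _ _)
  refine ⟨1 / 4, by norm_num, ?_⟩
  intro r hr hr4 L κ hL hκ hκ1
  have hL0 : 0 < L := one_pos.trans_le hL
  have hr2 : r < 1 / 2 := hr4.trans (by norm_num)
  -- the mark `Ξ₁ᴸ`: measurable, bounded by `1`, vanishing at relative speed `≥ 2L`
  have hΞm : Measurable fun q : V3 × V3 × V3 => speedCutoff L ‖q.2.2 - q.2.1‖ :=
    (continuous_speedCutoff_mark L).measurable
  have hC : ∀ q : V3 × V3 × V3, |speedCutoff L ‖q.2.2 - q.2.1‖| ≤ 1 := fun q => abs_speedCutoff_le_one L _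
  have hΞL : ∀ m v v' : V3, 2 * L ≤ ‖v - v'‖ →
      (fun q : V3 × V3 × V3 => speedCutoff L ‖q.2.2 - q.2.1‖) (m, v, v') = 0 := fun m v v' hvv' => by
    show speedCutoff L ‖v' - v‖ = 0
    rw [norm_sub_rev]
    exact speedCutoff_eq_zero hL0 hvv'
  -- the constants
  obtain ⟨Cχ, hCχ, hχb⟩ := exists_pos_bound_on_strip hχ τ
  obtain ⟨Cg, hCg⟩ := exists_bound_of_vanishing hg hg0
  set Cp : ℝ := (3 + 4 * L * κ) ^ 3 with hCp
  set VL : ℝ := 4 / 3 * Real.pi * (1 + 2 * L * κ) ^ 3 with hVL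
  set K₁ : ℝ := 2 * (Cg * Cχ / κ) ^ 2 * (16 * Cp ^ 2 + 32 * VL * σ ^ 3 + 192 * VL ^ 2 * σ ^ 6) with hK₁
  set K₂ : ℝ := 2 * (Cg * Cχ / κ) ^ 2 * (8 * VL ^ 2 * σ ^ 6) with hK₂
  set K₃ : ℝ := 2 * (Cχ * Cp / κ) ^ 2 * 2 with hK₃
  set K₄ : ℝ := 2 * (Cχ * Cp / κ) ^ 2 * (8 * Cg ^ 2) with hK₄
  have hVL0 : 0 ≤ VL := by rw [hVL]; positivity
  have hK₁0 : 0 ≤ K₁ := by rw [hK₁]; positivity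
  have hK₂0 : 0 ≤ K₂ := by rw [hK₂]; positivity
  have hK₃0 : 0 ≤ K₃ := by rw [hK₃]; positivity
  have hK₄0 : 0 ≤ K₄ := by rw [hK₄]; positivity
  have hς4 : 0 < ς / 4 := by positivity
  -- the small parameters
  obtain ⟨ζ, hζ, -, hζK⟩ := exists_pos_mul_le hK₂0 hς4
  obtain ⟨ζ', hζ', hζ'1, hζ'K⟩ := exists_pos_mul_le hK₃0 hς4
  obtain ⟨δ, hδ, hmod⟩ := exists_modulus_at_cube hg hσ hζ'
  obtain ⟨η₄, hη₄, -, hη₄K⟩ := exists_pos_mul_le hK₄0 hς4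
  -- the thresholds in `N`
  obtain ⟨N₂, hN₂⟩ := exists_hsDiameter_mul_lt σ (1 + 2 * L * κ)
  obtain ⟨N₃, hN₃⟩ := hPl σ hσ hσ1 ζ hζ
  obtain ⟨N₄, hN₄⟩ := exists_posGibbs_sqDevEvent_le hsd one_pos hr hr2 hδ hη₄
  obtain ⟨N₅, hN₅⟩ := exists_nat_div_succ_le K₁ hς4
  refine ⟨max (max (max 1 N₂) (max N₃ N₄)) N₅, fun N hN t ht => ?_⟩
  have hN1 : 1 ≤ N := le_trans (le_trans (le_trans (le_max_left _ _) (le_max_left _ _)) (le_max_left _ _)) hN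
  have hN2' : N₂ ≤ N := le_trans (le_trans (le_trans (le_max_right _ _) (le_max_left _ _)) (le_max_left _ _)) hN
  have hN3' : N₃ ≤ N := le_trans (le_trans (le_trans (le_max_left _ _) (le_max_right _ _)) (le_max_left _ _)) hN
  have hN4' : N₄ ≤ N := le_trans (le_trans (le_trans (le_max_right _ _) (le_max_right _ _)) (le_max_left _ _)) hN
  have hN5' : N₅ ≤ N := le_trans (le_max_right _ _) hN
  -- the weight `h = χ(t, ·)/C_χ` fed to the plateau
  have hhm : Measurable fun y : T3 => χ (t, y) / Cχ := (hχ.comp (Continuous.prodMk_right t)).measurable.div_const _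
  have hh1 : ∀ y : T3, |χ (t, y) / Cχ| ≤ 1 := fun y => by
    rw [abs_div, abs_of_pos hCχ, div_le_one hCχ]; exact hχb t ht y
  have hdec := fun (i j i' j' : Fin (N + 1)) (hij : i ≠ j) (hii' : i ≠ i') (hij' : i ≠ j') (hji' : j ≠ i')
    (hjj' : j ≠ j') (hi'j' : i' ≠ j') (T T' : Set T3) (hT : MeasurableSet T) (hT' : MeasurableSet T') =>
    hN₃ N hN3' i j i' j' hij hii' hij' hji' hjj' hi'j' (fun y => χ (t, y) / Cχ) (fun y => χ (t, y) / Cχ) hhm hhm hh1 hh1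
      T T' hT hT'
  -- the generic bound at `C = 1`
  have hmain := variance_tubeStat_rung0_le_of_speedCutoff hsd ha hθ u hN1 (Φ N) hχ hCχ t (hχb t ht) hg hCg hΞm
    one_pos hC hL0.le hΞL hκ hr (hN₂ N hN2') hζ.le hdec hζ'.le hδ hmod
  -- the four terms
  have h1 : K₁ / ((N + 1 : ℕ) : ℝ) ≤ ς / 4 := hN₅ N hN5'
  have h2 : K₂ * ζ ≤ ς / 4 := hζK
  have h3 : K₃ * ζ' ^ 2 ≤ ς / 4 := by
    have hsq : ζ' ^ 2 ≤ ζ' := by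
      calc ζ' ^ 2 = ζ' * ζ' := sq ζ'
        _ ≤ ζ' * 1 := mul_le_mul_of_nonneg_left hζ'1 hζ'.le
        _ = ζ' := mul_one ζ'
    exact (mul_le_mul_of_nonneg_left hsq hK₃0).trans hζ'K
  have h4 : K₄ * (posGibbsMeasure (fun _ : T3 => (1 : ℝ)) (hsDiameter σ N) (N + 1)).real (sqDevEvent (N + 1) δ r) ≤ ς / 4 :=
    (mul_le_mul_of_nonneg_left (hN₄ N hN4') hK₄0).trans hη₄K
  have hsum : 2 * (Cg * Cχ / κ) ^ 2 *
        ((16 * (1 : ℝ) ^ 2 * ((3 + 4 * L * κ) ^ 3) ^ 2 + 32 * (1 : ℝ) ^ 2 * (4 / 3 * Real.pi * (1 + 2 * L * κ) ^ 3) * σ ^ 3 +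
            192 * (1 : ℝ) ^ 2 * (4 / 3 * Real.pi * (1 + 2 * L * κ) ^ 3) ^ 2 * σ ^ 6) / (N + 1 : ℕ) +
          8 * ζ * (1 : ℝ) ^ 2 * (4 / 3 * Real.pi * (1 + 2 * L * κ) ^ 3) ^ 2 * σ ^ 6) +
        2 * (1 * Cχ * (3 + 4 * L * κ) ^ 3 / κ) ^ 2 * (2 * ζ' ^ 2 + 8 * Cg ^ 2 *
          (posGibbsMeasure (fun _ : T3 => (1 : ℝ)) (hsDiameter σ N) (N + 1)).real (sqDevEvent (N + 1) δ r)) =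
      K₁ / ((N + 1 : ℕ) : ℝ) + K₂ * ζ + K₃ * ζ' ^ 2 +
        K₄ * (posGibbsMeasure (fun _ : T3 => (1 : ℝ)) (hsDiameter σ N) (N + 1)).real (sqDevEvent (N + 1) δ r) := by
    rw [hK₁, hK₂, hK₃, hK₄, hCp, hVL]; ring
  rw [hsum] at hmain
  linarith only [hmain, h1, h2, h3, h4]

/-! ## The assembly at the unit mark `Ξ₁ᴸ` -/

/-- **Uniform bound of the tube part at the unit mark** `A_t = tubeStat σ N χ g Ξ₁ᴸ r r 1 κ t` on
`[0, τ] × Config` (tree `exists_bound_tubeStat` with the bound `1` of the mark). [folklore] -/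
theorem exists_bound_tubeStat_unit (σ : ℝ) (N : ℕ) {χ : ℝ × UnitAddTorus (Fin 3) → ℝ}
    {g : ℝ → ℝ} (hχ : Continuous χ) (hg : Continuous g) (L : ℝ) {r κ : ℝ} (hr : 0 < r) (hκ : 0 ≤ κ) (τ : ℝ) :
    ∃ B : ℝ, ∀ t ∈ Set.Icc (0 : ℝ) τ, ∀ z : Config (N + 1) (Fin 3) T3,
      |tubeStat σ N χ g (fun q : V3 × V3 × V3 => speedCutoff L ‖q.2.2 - q.2.1‖) r r 1 κ t z| ≤ B :=
  exists_bound_tubeStat σ N hχ hg (exists_abs_speedCutoff_mark_le L) hr r zero_le_one hκ τ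

/-- **S4 at RUNG 0 at the unit mark from two STATIC inputs** (port of
`Theorems.EvenStressEnskog.fixedTimeVariance_rung0_of_static` to `Ξ₁ᴸ`, the mark indices dropped): the static tube
variance `Var_{G_N}(A_t) ≤ ς` (`hA`) and the static Enskog-rate variance with measurability (`hE`), in the crux's
quantifier frame, give the fixed-time variance `Var_{G_N}(W_t ∘ Φ_t) ≤ ς` — Gibbs invariance removes the flow from
both halves of the split `Var W ≤ 2 Var A + 2 σ⁶ Var e` (`variance_evenTubeStat_flow_le`,
`variance_comp_flow_localGibbsLaw_const`); `η₀ := min`, `σ₀ := min σ₁ σ₂ (1/2)`, inputs at `ς/4`,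
`r₀ := min`, `N₀ := max`. [folklore] -/
theorem fixedTimeVariance_unit_rung0_of_static
    (hA : ∃ η₀ : ℝ, 0 < η₀ ∧ ∀ (a θ : ℝ) (u : V3), 0 < a → 0 < θ → ∃ σ₀ : ℝ, 0 < σ₀ ∧
      ∀ σ : ℝ, 0 < σ → σ < σ₀ →
      ∀ Φ : (N : ℕ) → HardSphereFlow (Torus.geometry (Fin 3)) (hsDiameter σ N) (N + 1),
      ∀ τ : ℝ, 0 < τ → ∀ χ : ℝ × UnitAddTorus (Fin 3) → ℝ, Continuous χ → ∀ g : ℝ → ℝ, Continuous g →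
      (∀ a', η₀ ≤ a' → g a' = 0) →
      ∀ ς : ℝ, 0 < ς → ∃ r₀ : ℝ, 0 < r₀ ∧ ∀ r : ℝ, 0 < r → r < r₀ →
      ∀ L κ : ℝ, 1 ≤ L → 0 < κ → κ ≤ 1 → ∃ N₀ : ℕ, ∀ N : ℕ, N₀ ≤ N →
      ∀ t ∈ Set.Icc (0 : ℝ) τ,
        ProbabilityTheory.variance
          (fun z => tubeStat σ N χ g (fun q : V3 × V3 × V3 => speedCutoff L ‖q.2.2 - q.2.1‖) r r 1 κ t z)
          (localGibbsLaw σ (fun _ => a) (fun _ => u) (fun _ => θ) N (Φ N)) ≤ ς)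
    (hE : ∃ η₀ : ℝ, 0 < η₀ ∧ ∀ (a θ : ℝ) (u : V3), 0 < a → 0 < θ → ∃ σ₀ : ℝ, 0 < σ₀ ∧
      ∀ σ : ℝ, 0 < σ → σ < σ₀ →
      ∀ Φ : (N : ℕ) → HardSphereFlow (Torus.geometry (Fin 3)) (hsDiameter σ N) (N + 1),
      ∀ τ : ℝ, 0 < τ → ∀ χ : ℝ × UnitAddTorus (Fin 3) → ℝ, Continuous χ → ∀ g : ℝ → ℝ, Continuous g →
      (∀ a', η₀ ≤ a' → g a' = 0) →
      ∀ ς : ℝ, 0 < ς → ∃ r₀ : ℝ, 0 < r₀ ∧ ∀ r : ℝ, 0 < r → r < r₀ →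
      ∀ L κ : ℝ, 1 ≤ L → 0 < κ → κ ≤ 1 → ∃ N₀ : ℕ, ∀ N : ℕ, N₀ ≤ N →
      ∀ t ∈ Set.Icc (0 : ℝ) τ,
        (Measurable fun z => enskogRate σ N χ g (fun q : V3 × V3 × V3 => speedCutoff L ‖q.2.2 - q.2.1‖) r t z) ∧
        ProbabilityTheory.variance
          (fun z => enskogRate σ N χ g (fun q : V3 × V3 × V3 => speedCutoff L ‖q.2.2 - q.2.1‖) r t z)
          (localGibbsLaw σ (fun _ => a) (fun _ => u) (fun _ => θ) N (Φ N)) ≤ ς) :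
    ∃ η₀ : ℝ, 0 < η₀ ∧ ∀ (a θ : ℝ) (u : V3), 0 < a → 0 < θ → ∃ σ₀ : ℝ, 0 < σ₀ ∧ ∀ σ : ℝ, 0 < σ → σ < σ₀ →
      ∀ Φ : (N : ℕ) → HardSphereFlow (Torus.geometry (Fin 3)) (hsDiameter σ N) (N + 1),
      ∀ τ : ℝ, 0 < τ → ∀ χ : ℝ × UnitAddTorus (Fin 3) → ℝ, Continuous χ → ∀ g : ℝ → ℝ, Continuous g →
      (∀ a', η₀ ≤ a' → g a' = 0) →
      ∀ ς : ℝ, 0 < ς → ∃ r₀ : ℝ, 0 < r₀ ∧ ∀ r : ℝ, 0 < r → r < r₀ →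
      ∀ L κ : ℝ, 1 ≤ L → 0 < κ → κ ≤ 1 → ∃ N₀ : ℕ, ∀ N : ℕ, N₀ ≤ N → ∀ t ∈ Set.Icc (0 : ℝ) τ,
        ProbabilityTheory.variance
          (fun z => evenTubeStat σ N χ g (fun q : V3 × V3 × V3 => speedCutoff L ‖q.2.2 - q.2.1‖) r κ t
            ((Φ N).flow t z))
          (localGibbsLaw σ (fun _ => a) (fun _ => u) (fun _ => θ) N (Φ N)) ≤ ς := by
  obtain ⟨η₁, hη₁, HA⟩ := hA
  obtain ⟨η₂, hη₂, HE⟩ := hE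
  refine ⟨min η₁ η₂, lt_min hη₁ hη₂, ?_⟩
  intro a θ u ha hθ
  obtain ⟨σ₁, hσ₁, HA⟩ := HA a θ u ha hθ
  obtain ⟨σ₂, hσ₂, HE⟩ := HE a θ u ha hθ
  refine ⟨min (min σ₁ σ₂) (1 / 2), lt_min (lt_min hσ₁ hσ₂) (by norm_num), ?_⟩
  intro σ hσ hσlt Φ τ hτ χ hχ g hg hg0 ς hς
  have hσ12 : σ < min σ₁ σ₂ := lt_of_lt_of_le hσlt (min_le_left _ _)
  have hσhalf : σ ≤ 1 / 2 := (lt_of_lt_of_le hσlt (min_le_right _ _)).le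
  have hg1 : ∀ a', η₁ ≤ a' → g a' = 0 := fun a' h => hg0 a' ((min_le_left _ _).trans h)
  have hg2 : ∀ a', η₂ ≤ a' → g a' = 0 := fun a' h => hg0 a' ((min_le_right _ _).trans h)
  obtain ⟨r₁, hr₁, HA⟩ := HA σ hσ (lt_of_lt_of_le hσ12 (min_le_left _ _)) Φ τ hτ χ hχ g hg hg1
    (ς / 4) (by positivity)
  obtain ⟨r₂, hr₂, HE⟩ := HE σ hσ (lt_of_lt_of_le hσ12 (min_le_right _ _)) Φ τ hτ χ hχ g hg hg2
    (ς / 4) (by positivity)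
  refine ⟨min r₁ r₂, lt_min hr₁ hr₂, ?_⟩
  intro r hr hrlt L κ hL hκ hκ1
  obtain ⟨N₁, HA⟩ := HA r hr (lt_of_lt_of_le hrlt (min_le_left _ _)) L κ hL hκ hκ1
  obtain ⟨N₂, HE⟩ := HE r hr (lt_of_lt_of_le hrlt (min_le_right _ _)) L κ hL hκ hκ1
  refine ⟨max N₁ N₂, fun N hN t ht => ?_⟩
  have hA' := HA N ((le_max_left _ _).trans hN) t ht
  obtain ⟨hem, hE'⟩ := HE N ((le_max_right _ _).trans hN) t ht
  haveI : IsProbabilityMeasure (localGibbsLaw σ (fun _ => a) (fun _ => u) (fun _ => θ) N (Φ N)) :=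
    isProbabilityMeasure_localGibbsLaw continuous_const continuous_const continuous_const
      (fun _ => ha) (fun _ => hθ) hσhalf N (Φ N)
  obtain ⟨B, hB⟩ := exists_bound_tubeStat_unit σ N hχ hg L hr hκ.le τ
  have hsplit := variance_evenTubeStat_flow_le σ N hχ hg (continuous_speedCutoff_mark L) r κ t
    (Φ N) (localGibbsLaw σ (fun _ => a) (fun _ => u) (fun _ => θ) N (Φ N)) (fun z => hB t ht z) hem
  rw [variance_comp_flow_localGibbsLaw_const σ a θ u N (Φ N) t
      (measurable_tubeStat_at σ N hχ hg (continuous_speedCutoff_mark L) r r 1 κ t).aemeasurable,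
    variance_comp_flow_localGibbsLaw_const σ a θ u N (Φ N) t hem.aemeasurable] at hsplit
  exact split_le_of_le hsplit hA' hE' (variance_nonneg _ _) (cube_sq_le_one hσ.le (by linarith))

/-! ## The registered stub -/

/-- **R4 · THE FIXED-TIME VARIANCE AT RUNG 0, UNIT MARK, MODULO Plateau′** (registered rung-0 stub
`stub_fixedTimeVarianceUnitRung0` of the line `Sketch`, crux `InformationPercolationEngine.CollisionRate`,
stmt-AtomisticToContinuum-13481, verbatim): the decorrelation plateau Plateau′ of two disjoint decorated dimers
under the activity-`1` canonical configurational measure implies, under the canonical law of constant profiles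
`(ab, ub, θb)`, `Var_{G_N}(W_t ∘ Φ_t) ≤ ς` for the even tube functional `W_t = evenTubeStat σ N χ g Ξ₁ᴸ r κ t`
at the speed-truncated unit mark, uniformly in `t ∈ [0, τ]`, for `r < r₀`, `1 ≤ L`, `0 < κ ≤ 1`, `N ≥ N₀`
(`fixedTimeVariance_unit_rung0_of_static` fed by `tubeVariance_unit_rung0_of_plateau` and
`enskogRateVariance_unit_rung0`). [folklore] -/
theorem stub_fixedTimeVarianceUnitRung0 :
    (∃ σ₁ : ℝ, 0 < σ₁ ∧ ∀ σ : ℝ, 0 < σ → σ < σ₁ → ∀ ζ : ℝ, 0 < ζ → ∃ N₀ : ℕ, ∀ N : ℕ, N₀ ≤ N →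
      ∀ i j k l : Fin (N + 1), i ≠ j → i ≠ k → i ≠ l → j ≠ k → j ≠ l → k ≠ l →
      ∀ (h h' : T3 → ℝ), Measurable h → Measurable h' → (∀ y, |h y| ≤ 1) → (∀ y, |h' y| ≤ 1) →
      ∀ T T' : Set T3, MeasurableSet T → MeasurableSet T' →
        |(∫ x, h (x i) * T.indicator (fun _ => (1 : ℝ)) (x j - x i) * (h' (x k) * T'.indicator (fun _ => (1 : ℝ)) (x l - x k))
            ∂posGibbsMeasure (fun _ : T3 => (1 : ℝ)) (hsDiameter σ N) (N + 1)) -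
          (∫ x, h (x i) * T.indicator (fun _ => (1 : ℝ)) (x j - x i)
            ∂posGibbsMeasure (fun _ : T3 => (1 : ℝ)) (hsDiameter σ N) (N + 1)) *
          (∫ x, h' (x k) * T'.indicator (fun _ => (1 : ℝ)) (x l - x k)
            ∂posGibbsMeasure (fun _ : T3 => (1 : ℝ)) (hsDiameter σ N) (N + 1))| ≤
        ζ * (MeasureTheory.volume T).toReal * (MeasureTheory.volume T').toReal) →
    ∃ η₀ : ℝ, 0 < η₀ ∧ ∀ (ab θb : ℝ) (ub : V3), 0 < ab → 0 < θb → ∃ σ₀ : ℝ, 0 < σ₀ ∧ ∀ σ : ℝ, 0 < σ → σ < σ₀ →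
      ∀ Φ : (N : ℕ) → HardSphereFlow (Torus.geometry (Fin 3)) (hsDiameter σ N) (N + 1),
      ∀ τ : ℝ, 0 < τ → ∀ χ : ℝ × T3 → ℝ, Continuous χ → ∀ g : ℝ → ℝ, Continuous g →
      (∀ x, η₀ ≤ x → g x = 0) →
      ∀ ς : ℝ, 0 < ς → ∃ r₀ : ℝ, 0 < r₀ ∧ ∀ r : ℝ, 0 < r → r < r₀ →
      ∀ L κ : ℝ, 1 ≤ L → 0 < κ → κ ≤ 1 → ∃ N₀ : ℕ, ∀ N : ℕ, N₀ ≤ N → ∀ t ∈ Set.Icc (0 : ℝ) τ,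
        ProbabilityTheory.variance
          (fun z => evenTubeStat σ N χ g (fun q : V3 × V3 × V3 => speedCutoff L ‖q.2.2 - q.2.1‖) r κ t ((Φ N).flow t z))
          (localGibbsLaw σ (fun _ => ab) (fun _ => ub) (fun _ => θb) N (Φ N)) ≤ ς :=
  fun hPl => fixedTimeVariance_unit_rung0_of_static (tubeVariance_unit_rung0_of_plateau hPl)
    enskogRateVariance_unit_rung0


end Summit.AtomisticToContinuum.HydrodynamicLimit.Theorems.CollisionRate

end
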